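import Summits.NavierStokesRegularity.NavierStokesRegularity.Theorems.PerpetualPumpEulerTypeIGlueFourierL2
import Summits.NavierStokesRegularity.NavierStokesRegularity.Theorems.PerpetualPumpEulerTypeIGlueFourierDeriv
import Summits.NavierStokesRegularity.NavierStokesRegularity.Theorems.PerpetualPumpEulerTypeIGlueTripleProduct
import Literature.Analysis.FluidPDE.TaoAveragedEulerFormBound
import Literature.Analysis.FluidPDE.TaoAveragedComplexAverageReal
import Mathlib.Analysis.Fourier.FourierTransformDeriv

/-!
# Route PerpetualPump · `EulerTypeIGlue` — preparations for the identification of Tao's Euler form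
# (1.3) with the physical trilinear form

Support file for the support item `EulerTypeIGlue` (stmt-NavierStokesRegularity-1838) of route
PerpetualPump.  Preparatory lemmas (components of real `L²` fields on the Fourier side, the Fourier
transform of derivatives of complexified test fields, `Σᵢⱼ` bookkeeping, dominated integrability on
`ℝ³ × ℝ³`) for the main result of the sibling file `PerpetualPumpEulerTypeIGlueTrilinear`,
`eulerForm_toLp_eq_integral_inner_convect`: for a continuous bounded
real field `f` whose complexified `L²` class lies in `H¹⁰` and is Fourier-divergence-free, and a
`C¹` test field `ψ` with `ψ, Dψ ∈ L¹`, `ψ^ℂ ∈ L²`,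
`⟨B([f^ℂ],[f^ℂ]), [ψ^ℂ]⟩ = ∫ ⟪f, (f·∇)ψ⟫ dx`, where `⟨B(·,·),·⟩ = eulerForm` is Tao's Fourier-side
form (1.3)–(1.4) (`Literature/Analysis/FluidPDE/TaoAveragedSobolev.lean`).  Proof: write both sides
as `∑ᵢⱼ`; each scalar term `∫ fⱼ fᵢ ∂ᵢψⱼ` is a triple product `∫ a b c` with `a = 𝓕⁻¹A`, `b = 𝓕⁻¹B`,
`A, B, c ∈ L¹`, computed on the Fourier side (`integral_mul_mul_eq_integral_prod`, toolkit VI);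
`𝓕[∂ᵢψⱼ] = 2πi ξᵢ ψ̂ⱼ`; the divergence-free condition `f̂(ξ)·ξ = 0` and the symmetry of the double
integral identify the result with `-πi ∫∫ Λ`.

## References

* T. Tao, J. Amer. Math. Soc. 29 (2016), arXiv:1402.0290v3, §1.1 (1.3)–(1.4). [Tao2016AveragedNS]
* E. M. Stein, G. Weiss, *Introduction to Fourier Analysis on Euclidean Spaces* (1971), Ch. I,
  Thm. 1.15 (multiplication formula), Thm. 1.8 (derivatives).
-/

noncomputable section

open MeasureTheory Set Filter Topology FourierTransform SchwartzMap TemperedDistribution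
open scoped ENNReal NNReal FourierTransform RealInnerProductSpace ContDiff LineDeriv

set_option linter.dupNamespace false

namespace Summit.NavierStokesRegularity.NavierStokesRegularity.Theorems.PerpetualPumpEulerTypeIGlue


/-! ## The Euler form of Tao (1.3) against a physical-space trilinear form -/

section Trilinear

open Literature.Analysis.FluidPDE Literature.Analysis.FluidPDE.Tao2016
open Literature.Analysis.FunctionSpaces (eFourierSobolevNorm)
open Literature.Analysis.FunctionSpaces.EuclideanSpace (complexify complexify_apply norm_complexify
  continuous_complexify)

/-- Local notation for physical / frequency space `ℝ³`. -/
local notation "ℝ³" => EuclideanSpace ℝ (Fin 3)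
/-- Local notation for the complexified range `ℂ³`. -/
local notation "ℂ³" => EuclideanSpace ℂ (Fin 3)

/-! ### Small Fourier facts -/

/-- The inverse Fourier integral only depends on the a.e. class. [folklore] -/
theorem fourierInv_congr_ae {F : Type*} [NormedAddCommGroup F] [NormedSpace ℂ F] {f g : ℝ³ → F}
    (h : f =ᵐ[volume] g) : 𝓕⁻ f = 𝓕⁻ g := by
  funext x
  rw [Real.fourierInv_eq, Real.fourierInv_eq]
  refine integral_congr_ae ?_
  filter_upwards [h] with v hv
  rw [hv]

/-- The Fourier integral commutes with a complex-linear map of the range. [folklore] -/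
theorem fourier_clm_comp_apply {F F' : Type*} [NormedAddCommGroup F] [NormedSpace ℂ F] [CompleteSpace F]
    [NormedAddCommGroup F'] [NormedSpace ℂ F'] [CompleteSpace F'] (L : F →L[ℂ] F') {g : ℝ³ → F}
    (hg : Integrable g) (ξ : ℝ³) : 𝓕 (fun x => L (g x)) ξ = L (𝓕 g ξ) := by
  rw [Real.fourier_eq, Real.fourier_eq, ← ContinuousLinearMap.integral_comp_comm L
    ((Real.fourierIntegral_convergent_iff ξ).2 hg)]
  refine integral_congr_ae (Eventually.of_forall fun v => ?_)
  dsimp only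
  rw [Circle.smul_def, Circle.smul_def, L.map_smul]

/-- A coordinate of an integrable `ℂ³`-valued function is integrable. [folklore] -/
theorem integrable_apply_of_integrable {G : ℝ³ → ℂ³} (hG : Integrable G) (j : Fin 3) :
    Integrable (fun ξ => G ξ j) :=
  (EuclideanSpace.proj j : ℂ³ →L[ℂ] ℂ).integrable_comp hG

/-! ### The first moment of an `H¹⁰` Fourier transform is integrable -/

/-- `∫ (1+|ξ|²)^{-9} < ∞` on `ℝ³`. [folklore] -/
theorem lintegral_sobolevWeight_neg_nine_lt_top :
    ∫⁻ ξ : ℝ³, ENNReal.ofReal ((1 + ‖ξ‖ ^ 2) ^ (-9 : ℝ)) < ⊤ := by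
  have h := integrable_rpow_neg_one_add_norm_sq (E := ℝ³) (μ := (volume : Measure ℝ³)) (r := 18)
    (by rw [finrank_euclideanSpace, Fintype.card_fin]; norm_num)
  have h' : Integrable (fun ξ : ℝ³ => (1 + ‖ξ‖ ^ 2) ^ (-9 : ℝ)) := by
    refine h.congr (Eventually.of_forall fun ξ => ?_)
    norm_num
  exact h'.lintegral_lt_top

/-- **`|ξ| û ∈ L¹` for `u ∈ H¹⁰`**: `∫ |ξ| |f(ξ)| ≤ (∫(1+|ξ|²)^{-9})^{1/2} (∫ (1+|ξ|²)^{10} |f|²)^{1/2}`. [folklore] -/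
theorem lintegral_norm_mul_enorm_le_sobolevWeight {f : ℝ³ → ℂ³} (hf : AEStronglyMeasurable f volume) :
    ∫⁻ ξ, ‖ξ‖ₑ * ‖f ξ‖ₑ ≤
      (∫⁻ ξ : ℝ³, ENNReal.ofReal ((1 + ‖ξ‖ ^ 2) ^ (-9 : ℝ))) ^ (1 / 2 : ℝ) *
        sobolevWeightIntegral 10 f ^ (1 / 2 : ℝ) := by
  have hw : ∀ s : ℝ, Measurable fun ξ : ℝ³ => ENNReal.ofReal ((1 + ‖ξ‖ ^ 2) ^ s) := measurable_sobolevWeight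
  unfold sobolevWeightIntegral
  -- `|ξ| ≤ (1+|ξ|²)^{-9/2} (1+|ξ|²)^{5}`
  have hpt : ∀ ξ : ℝ³, ‖ξ‖ₑ ≤ ENNReal.ofReal ((1 + ‖ξ‖ ^ 2) ^ (-(9 : ℝ) / 2)) *
      ENNReal.ofReal ((1 + ‖ξ‖ ^ 2) ^ (5 : ℝ)) := by
    intro ξ
    have h0 : 0 < 1 + ‖ξ‖ ^ 2 := by positivity
    rw [← ENNReal.ofReal_mul (Real.rpow_nonneg h0.le _), ← Real.rpow_add h0, ← ofReal_norm]
    refine ENNReal.ofReal_le_ofReal ?_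
    have : -(9 : ℝ) / 2 + 5 = 1 / 2 := by norm_num
    rw [this, ← Real.sqrt_eq_rpow]
    refine Real.le_sqrt_of_sq_le ?_
    nlinarith [norm_nonneg ξ]
  have hsq : ∀ (s : ℝ) (ξ : ℝ³),
      ENNReal.ofReal ((1 + ‖ξ‖ ^ 2) ^ s) ^ (2 : ℝ) = ENNReal.ofReal ((1 + ‖ξ‖ ^ 2) ^ (2 * s)) := by
    intro s ξ
    have h0 : 0 < 1 + ‖ξ‖ ^ 2 := by positivity
    rw [ENNReal.ofReal_rpow_of_nonneg (Real.rpow_nonneg h0.le _) (by norm_num), ← Real.rpow_mul h0.le,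
      mul_comm]
  calc ∫⁻ ξ, ‖ξ‖ₑ * ‖f ξ‖ₑ
      ≤ ∫⁻ ξ, ENNReal.ofReal ((1 + ‖ξ‖ ^ 2) ^ (-(9 : ℝ) / 2)) *
          (ENNReal.ofReal ((1 + ‖ξ‖ ^ 2) ^ (5 : ℝ)) * ‖f ξ‖ₑ) := by
        refine lintegral_mono fun ξ => ?_
        rw [← mul_assoc]
        exact mul_le_mul' (hpt ξ) le_rfl
    _ ≤ (∫⁻ ξ, ENNReal.ofReal ((1 + ‖ξ‖ ^ 2) ^ (-(9 : ℝ) / 2)) ^ (2 : ℝ)) ^ (1 / (2 : ℝ)) *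
          (∫⁻ ξ, (ENNReal.ofReal ((1 + ‖ξ‖ ^ 2) ^ (5 : ℝ)) * ‖f ξ‖ₑ) ^ (2 : ℝ)) ^ (1 / (2 : ℝ)) :=
        ENNReal.lintegral_mul_le_Lp_mul_Lq volume Real.HolderConjugate.two_two (hw _).aemeasurable
          ((hw _).aemeasurable.mul hf.enorm)
    _ = _ := by
        congr 2
        · refine lintegral_congr fun ξ => ?_
          rw [hsq]
          norm_num
        · refine lintegral_congr fun ξ => ?_
          rw [ENNReal.mul_rpow_of_nonneg _ _ (by norm_num : (0 : ℝ) ≤ 2), hsq, ENNReal.rpow_two]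
          norm_num

/-- For `u ∈ H¹⁰(ℝ³; ℂ³)`: `û ∈ L¹` and `|ξ| û ∈ L¹` (as real integrability statements). [folklore] -/
theorem integrable_fourierFn_and_moment {u : L2C} (hu : eFourierSobolevNorm 10 u < ⊤) :
    Integrable (fourierFn u) ∧ Integrable (fun ξ : ℝ³ => ‖ξ‖ * ‖fourierFn u ξ‖) := by
  have hmeas := aestronglyMeasurable_fourierFn u
  have hS : sobolevWeightIntegral 10 (fourierFn u) ^ (1 / 2 : ℝ) < ⊤ := by rw [← eFourierSobolevNorm_eq]; exact hu
  constructor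
  · refine ⟨hmeas, ?_⟩
    refine lt_of_le_of_lt (lintegral_enorm_le_sobolevWeight hmeas) (ENNReal.mul_lt_top ?_ hS)
    exact ENNReal.rpow_lt_top_of_nonneg (by norm_num) lintegral_inv_sobolevWeight_lt_top.ne
  · refine ⟨(continuous_norm.aestronglyMeasurable).mul hmeas.norm, ?_⟩
    have h1 : ∫⁻ ξ, ‖‖ξ‖ * ‖fourierFn u ξ‖‖ₑ = ∫⁻ ξ : ℝ³, ‖ξ‖ₑ * ‖fourierFn u ξ‖ₑ := by
      refine lintegral_congr fun ξ => ?_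
      rw [Real.enorm_eq_ofReal (by positivity), ENNReal.ofReal_mul (norm_nonneg _), ofReal_norm, ofReal_norm]
    rw [hasFiniteIntegral_iff_enorm, h1]
    refine lt_of_le_of_lt (lintegral_norm_mul_enorm_le_sobolevWeight hmeas) (ENNReal.mul_lt_top ?_ hS)
    exact ENNReal.rpow_lt_top_of_nonneg (by norm_num) lintegral_sobolevWeight_neg_nine_lt_top.ne

/-! ### The components of a real `L²` field on the Fourier side -/

variable {f : ℝ³ → ℝ³}

/-- The `L²` class of the `j`-th complexified component is the projection of the class. [folklore] -/
theorem coeFn_proj_compLp_toLp (h2 : MemLp (complexify ∘ f) 2 (volume : Measure ℝ³)) (j : Fin 3) :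
    (((EuclideanSpace.proj j : ℂ³ →L[ℂ] ℂ).compLp (h2.toLp _) : Lp ℂ 2 (volume : Measure ℝ³)) : ℝ³ → ℂ)
      =ᵐ[volume] fun x => ((f x j : ℝ) : ℂ) := by
  filter_upwards [ContinuousLinearMap.coeFn_compLp (EuclideanSpace.proj j : ℂ³ →L[ℂ] ℂ) (h2.toLp _),
    h2.coeFn_toLp] with x hx hx'
  rw [hx, hx']
  simp [PiLp.proj_apply, complexify_apply]

/-- **A component of an `H¹⁰` real field is the inverse Fourier integral of the corresponding
component of its Fourier transform**: `f_j = 𝓕⁻¹(û_j)` a.e., `û = fourierFn [f^ℂ]`. [folklore] -/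
theorem component_ae_eq_fourierInv (h2 : MemLp (complexify ∘ f) 2 (volume : Measure ℝ³))
    (hH : eFourierSobolevNorm 10 (h2.toLp _) < ⊤) (j : Fin 3) :
    (fun x => ((f x j : ℝ) : ℂ)) =ᵐ[volume] 𝓕⁻ (fun ξ => fourierFn (h2.toLp _) ξ j) := by
  set u : Lp ℂ 2 (volume : Measure ℝ³) := (EuclideanSpace.proj j : ℂ³ →L[ℂ] ℂ).compLp (h2.toLp _) with hu
  have hFu : ((𝓕 u : Lp ℂ 2 (volume : Measure ℝ³)) : ℝ³ → ℂ) =ᵐ[volume] fun ξ => fourierFn (h2.toLp _) ξ j := by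
    filter_upwards [fourier_compLp_ae_eq (EuclideanSpace.proj j : ℂ³ →L[ℂ] ℂ) (h2.toLp (complexify ∘ f))]
      with ξ hξ
    rw [hu, hξ]
    rfl
  have hint : Integrable ((𝓕 u : Lp ℂ 2 (volume : Measure ℝ³)) : ℝ³ → ℂ) :=
    (integrable_apply_of_integrable (integrable_fourierFn_and_moment hH).1 j).congr hFu.symm
  have h := coeFn_ae_eq_fourierInv u hint
  rw [fourierInv_congr_ae hFu] at h
  exact (coeFn_proj_compLp_toLp h2 j).symm.trans h

/-! ### The Fourier transform of the derivative of the complexified test field -/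

variable {ψ : ℝ³ → ℝ³}

/-- The complexified test field and its derivative. [folklore] -/
theorem fderiv_complexify_comp_eq (hψ : Differentiable ℝ ψ) (x : ℝ³) :
    fderiv ℝ (complexify ∘ ψ) x = complexify.toContinuousLinearMap.comp (fderiv ℝ ψ x) := by
  rw [show (complexify ∘ ψ) = (⇑complexify.toContinuousLinearMap ∘ ψ) from rfl]
  exact (complexify.toContinuousLinearMap.hasFDerivAt.comp x (hψ x).hasFDerivAt).fderiv

/-- The derivative of the complexified test field is integrable when `Dψ` is. [folklore] -/
theorem integrable_fderiv_complexify_comp (hψ : Differentiable ℝ ψ) (hψ' : Integrable (fderiv ℝ ψ)) :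
    Integrable (fderiv ℝ (complexify ∘ ψ)) := by
  have h := ((ContinuousLinearMap.compL ℝ ℝ³ ℝ³ ℂ³) complexify.toContinuousLinearMap).integrable_comp hψ'
  refine h.congr (Eventually.of_forall fun x => ?_)
  rw [fderiv_complexify_comp_eq hψ x]
  rfl

/-- **`𝓕[(∂_m ψ)^ℂ_j](ξ) = 2πi ⟨ξ, m⟩ 𝓕[ψ^ℂ](ξ)_j`** for an integrable `C¹` field with integrable
derivative (Mathlib `Real.fourier_fderiv`). [folklore] -/
theorem fourier_component_fderiv (hψc : ContDiff ℝ 1 ψ) (hψ1 : Integrable (complexify ∘ ψ))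
    (hψ' : Integrable (fderiv ℝ ψ)) (m ξ : ℝ³) (j : Fin 3) :
    𝓕 (fun x => ((fderiv ℝ ψ x m j : ℝ) : ℂ)) ξ =
      (2 * Real.pi * Complex.I) * ((⟪ξ, m⟫ : ℝ) : ℂ) * 𝓕 (complexify ∘ ψ) ξ j := by
  have hdiff : Differentiable ℝ ψ := hψc.differentiable one_ne_zero
  have hdiffc : Differentiable ℝ (complexify ∘ ψ) :=
    complexify.toContinuousLinearMap.differentiable.comp hdiff
  have hint := integrable_fderiv_complexify_comp hdiff hψ'
  -- the scalar component as `proj_j (D(ψ^ℂ) m)`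
  have hfun : (fun x => ((fderiv ℝ ψ x m j : ℝ) : ℂ)) =
      fun x => (EuclideanSpace.proj j : ℂ³ →L[ℂ] ℂ) (fderiv ℝ (complexify ∘ ψ) x m) := by
    funext x
    rw [fderiv_complexify_comp_eq hdiff x]
    simp [PiLp.proj_apply, complexify_apply]
  rw [hfun, fourier_clm_comp_apply (EuclideanSpace.proj j : ℂ³ →L[ℂ] ℂ) (hint.apply_continuousLinearMap m),
    ← Real.fourier_continuousLinearMap_apply hint, Real.fourier_fderiv hψ1 hdiffc hint,
    VectorFourier.fourierSMulRight_apply]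
  simp only [neg_apply, neg_smul, smul_neg, neg_neg, PiLp.proj_apply]
  rw [PiLp.smul_apply, PiLp.smul_apply, smul_eq_mul, Complex.real_smul, innerSL_apply_apply]
  ring

/-! ### Physical-space bookkeeping: `⟪f, (f·∇)ψ⟫ = Σᵢⱼ fⱼ fᵢ ∂ᵢψⱼ` -/

/-- The standard unit vectors `e i`. -/
local notation "𝐞ᵤ" i => (EuclideanSpace.single i (1 : ℝ) : EuclideanSpace ℝ (Fin 3))

/-- `Dψ(x)(v) = Σᵢ vᵢ Dψ(x)(eᵢ)`. [folklore] -/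
theorem clm_apply_eq_sum (L : ℝ³ →L[ℝ] ℝ³) (v : ℝ³) : L v = ∑ i, v i • L (𝐞ᵤ i) := by
  conv_lhs => rw [← (EuclideanSpace.basisFun (Fin 3) ℝ).sum_repr v]
  rw [map_sum]
  refine Finset.sum_congr rfl fun i _ => ?_
  rw [map_smul, EuclideanSpace.basisFun_repr, EuclideanSpace.basisFun_apply]

/-- `⟪f, Dψ(f)⟫ = Σᵢ Σⱼ fⱼ fᵢ (Dψ eᵢ)ⱼ`. [folklore] -/
theorem inner_clm_apply_eq_sum (L : ℝ³ →L[ℝ] ℝ³) (v : ℝ³) :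
    ⟪v, L v⟫ = ∑ i, ∑ j, v j * v i * L (𝐞ᵤ i) j := by
  rw [clm_apply_eq_sum L v, inner_sum]
  refine Finset.sum_congr rfl fun i _ => ?_
  rw [inner_smul_right, PiLp.inner_apply, Finset.mul_sum]
  refine Finset.sum_congr rfl fun j _ => ?_
  simp only [RCLike.inner_apply, conj_trivial]
  ring

/-! ### Fourier-side algebra -/

/-- `Σᵢ Σⱼ Xⱼ Yᵢ (c zᵢ Zⱼ) = c (Y·z) (X·Z)`. [folklore] -/
theorem sum_sum_eq_cdot (X Y Z z : ℂ³) (c : ℂ) :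
    ∑ i, ∑ j, X j * Y i * (c * z i * Z j) = c * cdot Y z * cdot X Z := by
  simp only [cdot, Fin.sum_univ_three]
  ring

/-- `G · (-ξ₁-ξ₂)^ℂ = -(G · ξ₁^ℂ) - G · ξ₂^ℂ`. [folklore] -/
theorem cdot_complexify_neg_sub (X : ℂ³) (ξ₁ ξ₂ : ℝ³) :
    cdot X (complexify (-ξ₁ - ξ₂)) = -cdot X (complexify ξ₁) - cdot X (complexify ξ₂) := by
  rw [map_sub, map_neg, cdot_sub_right', cdot_neg_right']
where
  /-- local copies of the `cdot` algebra (the tree versions live in heavier files) -/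
  cdot_sub_right' (a b c : ℂ³) : cdot a (b - c) = cdot a b - cdot a c := by
    simp only [cdot, PiLp.sub_apply, mul_sub, Finset.sum_sub_distrib]
  cdot_neg_right' (a b : ℂ³) : cdot a (-b) = -cdot a b := by
    simp only [cdot, PiLp.neg_apply, mul_neg, Finset.sum_neg_distrib]

/-! ### Integrability on frequency space `ℝ³ × ℝ³` -/

/-- The basic dominating function `(‖ξ₁‖ + ‖ξ₂‖ + 1) ‖G ξ₁‖ ‖G ξ₂‖` is integrable on `ℝ³ × ℝ³` when
`G, |ξ|G ∈ L¹`. [folklore] -/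
theorem integrable_dominator {G : ℝ³ → ℂ³} (hG : Integrable G)
    (hGm : Integrable (fun ξ : ℝ³ => ‖ξ‖ * ‖G ξ‖)) :
    Integrable (fun p : ℝ³ × ℝ³ => (‖p.1‖ + ‖p.2‖ + 1) * ‖G p.1‖ * ‖G p.2‖) (volume.prod volume) := by
  have h1 : Integrable (fun p : ℝ³ × ℝ³ => (‖p.1‖ * ‖G p.1‖) * ‖G p.2‖) (volume.prod volume) :=
    hGm.mul_prod hG.norm
  have h2 : Integrable (fun p : ℝ³ × ℝ³ => ‖G p.1‖ * (‖p.2‖ * ‖G p.2‖)) (volume.prod volume) :=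
    hG.norm.mul_prod hGm
  have h3 : Integrable (fun p : ℝ³ × ℝ³ => ‖G p.1‖ * ‖G p.2‖) (volume.prod volume) :=
    hG.norm.mul_prod hG.norm
  refine ((h1.add h2).add h3).congr (Eventually.of_forall fun p => ?_)
  simp only [Pi.add_apply]
  ring

/-- Integrability of a frequency-space integrand dominated by `C (‖ξ₁‖+‖ξ₂‖+1) ‖G ξ₁‖ ‖G ξ₂‖`. [folklore] -/
theorem integrable_of_dominated {G : ℝ³ → ℂ³} (hG : Integrable G)
    (hGm : Integrable (fun ξ : ℝ³ => ‖ξ‖ * ‖G ξ‖)) {Φ : ℝ³ × ℝ³ → ℂ}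
    (hΦm : AEStronglyMeasurable Φ (volume.prod volume)) {C : ℝ}
    (hΦ : ∀ p : ℝ³ × ℝ³, ‖Φ p‖ ≤ C * ((‖p.1‖ + ‖p.2‖ + 1) * ‖G p.1‖ * ‖G p.2‖)) :
    Integrable Φ (volume.prod volume) :=
  Integrable.mono' ((integrable_dominator hG hGm).const_mul C) hΦm (Eventually.of_forall hΦ)

/-! ### The main identification -/

end Trilinear

end Summit.NavierStokesRegularity.NavierStokesRegularity.Theorems.PerpetualPumpEulerTypeIGlue

end
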